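import Literature.NumberTheory.LFunctions.BPZProductMollifiedMoments
import HarnessLib

/-!
# Bui–Pratt–Zaharescu 2024, §4–§5: the mollified first moments through the singular sum `S₁(u)`
# (the display of §4 / proof of Prop. 2.1, Lemmas 5.1 and 5.2, AS PRINTED) — and the singular sum
# as a functional of GENERAL mollifier coefficients (definition only)

Source: H. M. Bui, K. Pratt, A. Zaharescu, *Analytic ranks of automorphic L-functions and
Landau–Siegel zeros*, J. London Math. Soc. 109 (2024) = arXiv:2102.03087 [held:
paper:arxiv-2102.03087], §4 p. 11 (the display after Lemma 3.4, (4.1)), §5 pp. 12–15 (Lemma 5.1,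
Lemma 5.2, proof of Proposition 2.1). Continues `BPZProductMollifiedMoments` (namespace `BPZ2024`, same
conventions: `q` prime, `ψ` real odd primitive mod `D`, «`D` large» = `∃ D₀`, «`L(1,ψ) log D = o(1)`» =
`∃ δ₀ > 0`, one constant `K` per `(ε, A)`).

Typed for the LANDAU–SIEGEL PROGRAMME, cell `landau-siegel`, §B-fam, derivation D-fam-2 (functional
layer on BPZ's class, B-fam/PLAN.md v1.3 §9b/§10): the source evaluates the mollified first moments
of `Λ'_{f,ψ}(½)`, `Λ''_{f,ψ}(½)` for its mollifier `M_{f,ψ} = Σ_{a≤X} ρ₁(a)λ_f(a)a^{−1/2}` as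
`2(1+ψ(q))·S₁(0)·L'(1,ψ)`, resp. `4(1−ψ(q))·[S₁(0)(L''(1,ψ)+(log Q−2γ)L'(1,ψ)) + S₁'(0)L'(1,ψ)]`, up to
the printed errors, where `S₁(u) = Σ_{n≤X} ρ₁(n)(1⋆ψ)(n)n^{−1−u}` (4.1) — i.e. the main term is a LINEAR
functional of the coefficient sequence. `BPZ2024.singularSum ρ ψ X u` is that functional for an
arbitrary coefficient sequence `ρ` (a DEFINITION; the facts below are stated, as printed, for `ρ = ρ₁`
only: the source's derivation (Lemma 3.4, Lemma 3.2, the contour shift of §4) uses `ρ₁` through the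
bound `ρ₁(a) ≪_ε (log q)^ε τ(a)` (p. 5, p. 11) — the general-`ρ` statement is the cell's derivation
target, NOT asserted here). FRAMING: the programme SEARCHES and TYPES; nothing here is a claim about
Landau–Siegel zeros.

## What is typed

* Definitions `BPZ2024.oneStarPsi` (`(1⋆ψ)(n) = Σ_{d∣n} ψ(d)`), `BPZ2024.singularSum ρ ψ X u`
  (`Σ_{1≤n≤X} ρ(n)(1⋆ψ)(n) n^{−(1+u)}`), `BPZ2024.S1u ψ X u` (`S₁(u)` of (4.1) = `singularSum (rho1 ψ)`).
* Named facts AS PRINTED: `buiPrattZaharescu2024_section4_first` / `_second` (the two displays «By the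
  work of Section 4, we have …» in the proof of Prop. 2.1, p. 15), `buiPrattZaharescu2024_lemma51`
  (`S₁(0) = S₁ + O(…)`, `X ≥ D⁸`), `buiPrattZaharescu2024_lemma52` (`S₁'(0) ≪ …`, `X ≥ D⁸`).
* PROVED: `singularSum_rho1` (`S1u = singularSum (rho1 ψ)`, `rfl`).

## Faithfulness notes

* The §4/p. 15 displays are printed inside the proof of Prop. 2.1, hence under its provisos
  `q, X ≥ D⁸`; they are typed with those provisos. Lemmas 5.1/5.2 print `(log q)`-powers for a quantity
  depending on `X, ψ` only: the source's mollifier length is `X = q^θ ≤ q` throughout (§2.1 «`X ≍ q`»,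
  Props. 2.2–2.3 `D⁸X⁶ ≪ q^{1−ε}`), and the facts carry the explicit hypothesis `X ≤ q` (weaker than
  print if anything). `log log(1/x)/log(1/x)`, `x = ‖L(1,ψ)‖ log D`, is written out as a real expression.
* `L(1,ψ), L'(1,ψ), L''(1,ψ)` = Mathlib's `ψ.LFunction 1`, `deriv ψ.LFunction 1`,
  `iteratedDeriv 2 ψ.LFunction 1`; `S₁'(0) = deriv (S1u ψ X) 0`; `Q = BPZ2024.Qbpz q D`; `γ` =
  `Real.eulerMascheroniConstant`.

## References

* [BuiPrattZaharescu2023] §4 (4.1) p. 11; §5 Lemma 5.1 p. 12, Lemma 5.2 p. 13, proof of Prop. 2.1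
  p. 15 (held text pages p0011–p0015).
-/

noncomputable section

open scoped Real
open CongruenceSubgroup Complex Finset
open Literature.NumberTheory.EllipticCurves.ModularForms

namespace Literature.NumberTheory.LFunctions

namespace BPZ2024

variable {D : ℕ}

/-- `(1⋆ψ)(n) = Σ_{d ∣ n} ψ(d)` — the coefficients of `ζ(s)L(s,ψ)`, lacunary under an exceptional `ψ`
(BPZ Lemma 3.4, Lemmas 3.5–3.8). [cite: BuiPrattZaharescu2023, Lemma 3.4 (p. 7)] -/
def oneStarPsi (ψ : DirichletCharacter ℂ D) (n : ℕ) : ℂ :=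
  ∑ d ∈ n.divisors, ψ d

/-- **The singular sum as a functional of the mollifier coefficients**:
`singularSum ρ ψ X u = Σ_{1 ≤ n ≤ X} ρ(n) (1⋆ψ)(n) n^{−(1+u)}`. For `ρ = ρ₁` this is the printed
`S₁(u)` of (4.1); for a general coefficient sequence `ρ` it is the cell's first-moment functional
(«BPZcompat.firstForm» `= singularSum ρ ψ X 0`; definition only — no statement about general `ρ` is
asserted in this file). [cite: BuiPrattZaharescu2023, §4 (4.1)] -/
def singularSum (ρ : ℕ → ℂ) (ψ : DirichletCharacter ℂ D) (X : ℝ) (u : ℂ) : ℂ :=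
  ∑ n ∈ Icc 1 ⌊X⌋₊, ρ n * oneStarPsi ψ n * (n : ℂ) ^ (-(1 + u))

/-- **`S₁(u) = Σ_{n ≤ X} ρ₁(n)(1⋆ψ)(n) n^{−1−u}`** (BPZ (4.1)), as a function of `u`.
[cite: BuiPrattZaharescu2023, §4 (4.1)] -/
def S1u (ψ : DirichletCharacter ℂ D) (X : ℝ) (u : ℂ) : ℂ :=
  singularSum (rho1 ψ) ψ X u

/-- `S₁(u)` is the singular-sum functional at `ρ = ρ₁`. [cite: BuiPrattZaharescu2023, §4 (4.1)] -/
theorem singularSum_rho1 (ψ : DirichletCharacter ℂ D) (X : ℝ) :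
    S1u ψ X = singularSum (rho1 ψ) ψ X := rfl

end BPZ2024

/-! ### Named facts (Bui–Pratt–Zaharescu 2024, §4–§5), as printed -/

section Facts

open BPZ2024

/-- **BPZ 2024, §4 / proof of Prop. 2.1 (p. 15), first display.** Printed: «By the work of Section 4,
we have `Σʰ_{f ∈ S₂*(q)} Λ'_{f,ψ}(½) M_{f,ψ} = 2(1 + ψ(q)) S₁(0) L'(1,ψ) + O_ε(L(1,ψ)(log q)^{5+ε}) +
O_ε(q^{−1/2+ε} D X)`», `S₁(u)` as in (4.1); inside the proof of Prop. 2.1, so under its provisos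
`q, X ≥ D⁸` and the standing ones (`q` prime, `ψ` real odd primitive mod `D`, `D` large,
`L(1,ψ) log D = o(1)`). [cite: BuiPrattZaharescu2023, §5 proof of Prop. 2.1 (p. 15, first display)] -/
def buiPrattZaharescu2024_section4_first : Prop :=
  ∀ ε : ℝ, 0 < ε →
    ∃ K : ℝ, 0 < K ∧ ∃ δ₀ : ℝ, 0 < δ₀ ∧ ∃ D₀ : ℕ, ∀ (D : ℕ) [NeZero D], D₀ ≤ D →
      ∀ ψ : DirichletCharacter ℂ D, ψ.IsPrimitive → ψ.IsQuadratic → ψ.Odd →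
        ‖ψ.LFunction 1‖ * Real.log D ≤ δ₀ →
        ∀ (q : ℕ) [NeZero q], q.Prime → (D : ℝ) ^ (8 : ℝ) ≤ (q : ℝ) → ∀ X : ℝ, (D : ℝ) ^ (8 : ℝ) ≤ X →
          ‖GL2Family.harmonicSum q 2 (fun f ↦ LambdaProdDeriv q ψ 1 f * mollifier q ψ X f) -
              2 * (1 + ψ (q : ZMod D)) * S1u ψ X 0 * deriv ψ.LFunction 1‖ ≤
            K * (‖ψ.LFunction 1‖ * Real.log q ^ (5 + ε) + (q : ℝ) ^ (-(1 / 2 : ℝ) + ε) * D * X)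

/-- **BPZ 2024, §4 / proof of Prop. 2.1 (p. 15), second display.** Printed: «We also have
`Σʰ_{f ∈ S₂*(q)} Λ''_{f,ψ}(½) M_{f,ψ} = 4(1 − ψ(q)) S₁(0) (L''(1,ψ) + (log Q − 2γ)L'(1,ψ))
+ 4(1 − ψ(q)) S₁'(0) L'(1,ψ) + O_ε(L(1,ψ)(log q)^{6+ε}) + O_ε(q^{−1/2+ε} D X)`», `Q = qD/4π²`,
`γ` Euler's constant; same provisos. [cite: BuiPrattZaharescu2023, §5 proof of Prop. 2.1 (p. 15, second display)] -/
def buiPrattZaharescu2024_section4_second : Prop :=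
  ∀ ε : ℝ, 0 < ε →
    ∃ K : ℝ, 0 < K ∧ ∃ δ₀ : ℝ, 0 < δ₀ ∧ ∃ D₀ : ℕ, ∀ (D : ℕ) [NeZero D], D₀ ≤ D →
      ∀ ψ : DirichletCharacter ℂ D, ψ.IsPrimitive → ψ.IsQuadratic → ψ.Odd →
        ‖ψ.LFunction 1‖ * Real.log D ≤ δ₀ →
        ∀ (q : ℕ) [NeZero q], q.Prime → (D : ℝ) ^ (8 : ℝ) ≤ (q : ℝ) → ∀ X : ℝ, (D : ℝ) ^ (8 : ℝ) ≤ X →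
          ‖GL2Family.harmonicSum q 2 (fun f ↦ LambdaProdDeriv q ψ 2 f * mollifier q ψ X f) -
              (4 * (1 - ψ (q : ZMod D)) * S1u ψ X 0 *
                  (iteratedDeriv 2 ψ.LFunction 1 +
                    ((Real.log (Qbpz q D) - 2 * Real.eulerMascheroniConstant : ℝ) : ℂ) *
                      deriv ψ.LFunction 1) +
                4 * (1 - ψ (q : ZMod D)) * deriv (S1u ψ X) 0 * deriv ψ.LFunction 1)‖ ≤
            K * (‖ψ.LFunction 1‖ * Real.log q ^ (6 + ε) + (q : ℝ) ^ (-(1 / 2 : ℝ) + ε) * D * X)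

/-- **BPZ 2024, Lemma 5.1.** Printed: «Provided that `X ≥ D⁸` we have
`S₁(0) = S₁ + O_ε(L(1,ψ)(log q)^{5+ε}) + O_A((log q)^{−A})`, where `S₁` is given by (2.6)» (standing:
`ψ` real odd primitive mod `D`, `D` large, `L(1,ψ) log D = o(1)`; the source's mollifier length
satisfies `X ≤ q`, carried as a hypothesis). [cite: BuiPrattZaharescu2023, Lemma 5.1 (p. 12)] -/
def buiPrattZaharescu2024_lemma51 : Prop :=
  ∀ ε : ℝ, 0 < ε → ∀ A : ℝ, 0 < A →
    ∃ K : ℝ, 0 < K ∧ ∃ δ₀ : ℝ, 0 < δ₀ ∧ ∃ D₀ : ℕ, ∀ (D : ℕ) [NeZero D], D₀ ≤ D →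
      ∀ ψ : DirichletCharacter ℂ D, ψ.IsPrimitive → ψ.IsQuadratic → ψ.Odd →
        ‖ψ.LFunction 1‖ * Real.log D ≤ δ₀ →
        ∀ q : ℕ, q.Prime → ∀ X : ℝ, (D : ℝ) ^ (8 : ℝ) ≤ X → X ≤ (q : ℝ) →
          ‖S1u ψ X 0 - S1 ψ X‖ ≤ K * (‖ψ.LFunction 1‖ * Real.log q ^ (5 + ε) + Real.log q ^ (-A))

/-- **BPZ 2024, Lemma 5.2.** Printed: «With `S₁` given by (4.1) and `X ≥ D⁸` we have
`S₁'(0) ≪_{ε,A} S₁ · (log log(1/L(1,ψ) log D)/log(1/L(1,ψ) log D)) · log D + L(1,ψ)(log q)^{6+ε}`»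
(`S₁` in the bound = the Euler product (2.6); standing hypotheses; `X ≤ q` carried as a hypothesis;
`x = ‖L(1,ψ)‖ log D`). [cite: BuiPrattZaharescu2023, Lemma 5.2 (p. 13)] -/
def buiPrattZaharescu2024_lemma52 : Prop :=
  ∀ ε : ℝ, 0 < ε →
    ∃ K : ℝ, 0 < K ∧ ∃ δ₀ : ℝ, 0 < δ₀ ∧ ∃ D₀ : ℕ, ∀ (D : ℕ) [NeZero D], D₀ ≤ D →
      ∀ ψ : DirichletCharacter ℂ D, ψ.IsPrimitive → ψ.IsQuadratic → ψ.Odd →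
        ‖ψ.LFunction 1‖ * Real.log D ≤ δ₀ →
        ∀ q : ℕ, q.Prime → ∀ X : ℝ, (D : ℝ) ^ (8 : ℝ) ≤ X → X ≤ (q : ℝ) →
          ‖deriv (S1u ψ X) 0‖ ≤
            K * (‖S1 ψ X‖ *
                  (Real.log (Real.log (1 / (‖ψ.LFunction 1‖ * Real.log D))) /
                      Real.log (1 / (‖ψ.LFunction 1‖ * Real.log D)) * Real.log D) +
                ‖ψ.LFunction 1‖ * Real.log q ^ (6 + ε))

end Facts

end Literature.NumberTheory.LFunctions

end
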